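import Summits.QuantumFields.BalabanUV.Beta.CombHId2CopySum

/-!
# `BalabanUV.Beta.CombHId2Words` — binder row D1 (OWNER an2), (J-a) dictionary, (C2) at ORDER 2, part TWO-b (words): **THE THREE WORDS OF `K3OfK` UNDER THE
# SECOND BOND's COPY SUM** — `Σ'_n (K·dM_b)·K2_{b′+M′∘n} = (K·dM_b)·dper M (K2_{b′})`, `Σ'_n (K·dM_{b′+M′∘n})·K2_b = dper M (K·dM_{b′})·K2_b`,
# `Σ'_n K·W_{b,b′+M′∘n}·K = K·(x z ↦ Σ'_n W_{b,b′+M′∘n} x z)·K` (pointwise, `M = N·M′`), with their summabilities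

WHY.  `K3OfK K N S Mt W b b′ = −K·dM_b·K2_{b′} − K·dM_{b′}·K2_b − K·W_{bb′}·K` (`BalabanStepW2` :543) is the lattice second bond-derivative of the inverse; the
door binds two-bond tables with the SECOND bond's coarse-period copies summed pointwise (U21's `hW₂₂` shape).  Under that sum the two product words become
ℤ^{d+1} words with ONE periodised factor — the copies of `K2_{b′}` ∕ `dM_{b′}` are fine-period SHIFTS of one bi-localised kernel (C3c `K2OfK∕dM_translate_per`), so
gan24-p3's `comp_dper_apply_eq_tsum ∕ dper_comp_apply_eq_tsum` read backwards give `dper` of that factor —, and the `W` word is the sandwich of the copy-summed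
table (C3c `tsum_sandwich_family`).  The periodisation of the summed words is the sequel `CombHId2Periodised`.
WHAT ([folklore]; 0 `def`, 0 cited fact, 0 `def … : Prop`, 0 sorry): §0 existential localisation helpers (`exists_biLoc_comp_left ∕ _right ∕ _sandwich`,
`exists_decays_of_biLoc`, `biLoc_shiftK_negper`, `summable_apply_of_biLoc`, `dper_neg_sub_sub`); §1 `exists_biLoc_dM_K2OfK` (common constant and rate for
`dM` and `K2OfK`, `SecondOrderResponse.vertexFamily_dM ∕ _K2OfK`), **`tsum_word₁`**, **`tsum_word₂`**, `W_family`, **`tsum_word₃`**, `summable_words`.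
Hypotheses = C3a's (`hM hKinv hK hSt hS hMt hMloc`) + the far-small localisation of `W` at its first bond (`hW`, the shape `BalabanStepW2.biLoc_K3OfK_far` consumes).
NOT HERE: `K3OfK` ∕ `e4OfKW` assembled (→ `CombHId2Periodised`), the door's `hId₂`; nothing of Bałaban's asserted; `D1Tel` ∕ `D1Rep` OPEN; NOT (T-ID), NOT D1,
NEVER «G-an2-4 closed», NOT BetaPertH, NOT continuum, NOT Clay.

HONEST DEPENDENCY (page 1, mandatory): continuum YM on T⁴ ⇐ BetaPertH ∧ nine spine estimates (0/9 proved); BetaPertH ⇐ (D1) ∧ (D4) ∧ CAP+tail;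
G-an2-4 gates asym, D1 and NE2/3/4.  HONEST FRAMING (cell contract, verbatim): «discharging `BetaPertH` makes Bałaban's UV stability UNCONDITIONAL —
a real constructive-QFT result; it is NOT the continuum limit and NOT the Clay problem.»  ABSOLUTE RULE (cell charter, verbatim): «No internally-minted
statement may enter as a cited fact. Every hypothesis is either kernel-proved in this package or a verbatim quotation of a PUBLISHED theorem with page
reference. The manuscript(s) under audit are NOT citable for their own disputed steps — they are the thing under adjudication; programme-internal
(2001/route/tribunal) claims are never citable.»  Row D1 OWNER an2 (b2b-balaban-beta-an2) gen 44, 2026-08-23; over C3a∕C3c and gan24-p3's letters BY NAME.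
-/

noncomputable section

open scoped BigOperators

namespace Summit.QuantumFields.BalabanUV.Beta.CombHId2Words

open Literature.MathematicalPhysics.QuantumFieldTheory.Balaban1983to89
open Literature.MathematicalPhysics.QuantumFieldTheory.Balaban1983to89.Beta
open B12Sec2to5 (l1 l1_nonneg)
open B4TorusKernel.MultiPeriod (translate translate_apply)
open B4Reflection242 (translate_translate)
open B4Sect5Proof (latticeConst latticeConst_nonneg)
open ExpKernelCalculus (MKer Decays BiLoc VertexFamily comp shiftK comp_shiftK Zl Zl_nonneg l1_sub_symm)
open AffineAveraging (Site)
open OneStepResolventKernel (Fib LocStencil decays_mono biLoc_mono)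
open SecondOrderResponse (dM K2OfK vertexFamily_dM vertexFamily_K2OfK cdM_nonneg cK2_nonneg)
open BalabanStepJetsSucc (mmRead mmRead_inl_inl mmRead_inr_left mmRead_inr_right biLoc_comp_right)
open BalabanStepW2 (K3OfK vertexFamily_mono')
open BalabanStepJets (locStencil_mono)
open Summit.QuantumFields.BalabanUV.Beta.FP.KernelPeriodisationFibLoc (dper dper_apply dper_translate summable_dper decays_dper_diag comp_dper_left
  comp_dper_right comp_dper_apply_eq_tsum dper_comp_apply_eq_tsum decays_of_biLoc shiftK_eq_translate summable_exp_l1_translate)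
open Summit.QuantumFields.BalabanUV.Beta.CombHId1Letters (nsmul_translate)
open Summit.QuantumFields.BalabanUV.Beta.CombHId1Sandwich (dper_sandwich shiftK_of_translate_inv)
open Summit.QuantumFields.BalabanUV.Beta.CombHId2Letters (dper_dM dper_K2OfK)
open Summit.QuantumFields.BalabanUV.Beta.CombHId2CopySum (biLoc_tsum_family tsum_sandwich_family dper_shiftK_per comp_shiftK_of_inv
  dM_translate_per K2OfK_translate_per)

variable {d : ℕ} (M : Fin (d + 1) → ℕ) [∀ μ, NeZero (M μ)]

/-! ## §0 Existential localisation helpers -/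

section Helpers

variable {A V : MKer (d + 1) (Fib d)} {p q : Site (d + 1)} {CA δA CV δV : ℝ}

omit [∀ μ, NeZero (M μ)] in
/-- [folklore] decaying ∘ bi-localised is bi-localised (some constant, some positive rate). -/
theorem exists_biLoc_comp_left (hA : Decays A CA δA) (hδA : 0 < δA) (hV : BiLoc V p q CV δV) (hδV : 0 < δV) :
    ∃ C δ : ℝ, 0 < δ ∧ BiLoc (comp A V) p q C δ := by
  have hCA : 0 ≤ CA := hA.nonneg (Sum.inl 0)
  have hCV : 0 ≤ CV := hV.nonneg (Sum.inl 0)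
  have h0 : 0 < min δA δV := lt_min hδA hδV
  exact ⟨_, _, half_pos h0, ExpKernelCalculus.biLoc_comp_decays (decays_mono hA hCA le_rfl (min_le_left _ _))
    (biLoc_mono hV hCV (min_le_right _ _)) (half_pos h0).le (half_lt_self h0)⟩

omit [∀ μ, NeZero (M μ)] in
/-- [folklore] bi-localised ∘ decaying is bi-localised. -/
theorem exists_biLoc_comp_right (hV : BiLoc V p q CV δV) (hδV : 0 < δV) (hA : Decays A CA δA) (hδA : 0 < δA) :
    ∃ C δ : ℝ, 0 < δ ∧ BiLoc (comp V A) p q C δ := by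
  have hCA : 0 ≤ CA := hA.nonneg (Sum.inl 0)
  have hCV : 0 ≤ CV := hV.nonneg (Sum.inl 0)
  have h0 : 0 < min δA δV := lt_min hδA hδV
  exact ⟨_, _, half_pos h0, biLoc_comp_right (biLoc_mono hV hCV (min_le_right _ _)) (decays_mono hA hCA le_rfl (min_le_left _ _))
    (half_pos h0).le (half_lt_self h0)⟩

omit [∀ μ, NeZero (M μ)] in
/-- [folklore] the sandwich `A ∘ V ∘ A` of a bi-localised `V` between decaying `A`s is bi-localised. -/
theorem exists_biLoc_sandwich (hA : Decays A CA δA) (hδA : 0 < δA) (hV : BiLoc V p q CV δV) (hδV : 0 < δV) :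
    ∃ C δ : ℝ, 0 < δ ∧ BiLoc (comp (comp A V) A) p q C δ := by
  obtain ⟨C₁, δ₁, hδ₁, h₁⟩ := exists_biLoc_comp_left hA hδA hV hδV
  exact exists_biLoc_comp_right h₁ hδ₁ hA hδA

omit [∀ μ, NeZero (M μ)] in
/-- [folklore] a bi-localised kernel decays (some constant, the same rate). -/
theorem exists_decays_of_biLoc (hV : BiLoc V p q CV δV) (hδV : 0 < δV) : ∃ C δ : ℝ, 0 < δ ∧ Decays V C δ :=
  ⟨_, δV, hδV, decays_of_biLoc hV (hV.nonneg (Sum.inl 0)) hδV.le⟩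

omit [∀ μ, NeZero (M μ)] in
/-- [folklore] the kernel shifted by `M∘(−n)` is bi-localised at the centres moved by `+M∘n`. -/
theorem biLoc_shiftK_negper (hV : BiLoc V p q CV δV) (n : Site (d + 1)) :
    BiLoc (shiftK (fun i => (M i : ℤ) * (-n) i) V) (translate M p n) (translate M q n) CV δV := by
  intro x z a b
  rw [shiftK_eq_translate]
  have ex : translate M x (-n) - p = x - translate M p n := by
    funext i; simp only [Pi.sub_apply, translate_apply, Pi.neg_apply, mul_neg]; ring
  have ez : translate M z (-n) - q = z - translate M q n := by
    funext i; simp only [Pi.sub_apply, translate_apply, Pi.neg_apply, mul_neg]; ring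
  have h := hV (translate M x (-n)) (translate M z (-n)) a b
  rwa [ex, ez] at h

omit [∀ μ, NeZero (M μ)] in
/-- [folklore] a family bi-localised with constants `c · g n` (`g ≥ 0` summable, rate `≥ 0`) is pointwise summable in `n` (any centres). -/
theorem summable_apply_of_biLoc {T : Site (d + 1) → MKer (d + 1) (Fib d)} {pn qn : Site (d + 1) → Site (d + 1)} {c δ : ℝ}
    {g : Site (d + 1) → ℝ} (hT : ∀ n, BiLoc (T n) (pn n) (qn n) (c * g n) δ) (hδ : 0 ≤ δ) (hc : 0 ≤ c) (hg0 : ∀ n, 0 ≤ g n)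
    (hg : Summable g) (x z : Site (d + 1)) (a b : Fib d) : Summable fun n => T n x z a b := by
  refine Summable.of_norm_bounded (hg.mul_left c) fun n => ?_
  rw [Real.norm_eq_abs]
  refine (hT n x z a b).trans ?_
  have h1 : Real.exp (-δ * (l1 (x - pn n) + l1 (z - qn n))) ≤ 1 := by
    rw [Real.exp_le_one_iff]; exact mul_nonpos_of_nonpos_of_nonneg (neg_nonpos.2 hδ) (add_nonneg (l1_nonneg _) (l1_nonneg _))
  calc c * g n * Real.exp (-δ * (l1 (x - pn n) + l1 (z - qn n))) ≤ c * g n * 1 :=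
        mul_le_mul_of_nonneg_left h1 (mul_nonneg hc (hg0 n))
    _ = c * g n := mul_one _

/-- [folklore] `dper` of `−A − B − C` for bi-localised `A, B, C` (all three period sums converge). -/
theorem dper_neg_sub_sub {A B C : MKer (d + 1) (Fib d)} (hA : ∃ p q C₀ δ, 0 < δ ∧ BiLoc A p q C₀ δ) (hB : ∃ p q C₀ δ, 0 < δ ∧ BiLoc B p q C₀ δ)
    (hC : ∃ p q C₀ δ, 0 < δ ∧ BiLoc C p q C₀ δ) :
    dper M (fun x z a b => -(A x z a b) - B x z a b - C x z a b) = fun x z a b => -(dper M A x z a b) - dper M B x z a b - dper M C x z a b := by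
  obtain ⟨pa, qa, Ca, δa, hδa, hA⟩ := hA
  obtain ⟨pb, qb, Cb, δb, hδb, hB⟩ := hB
  obtain ⟨pc, qc, Cc, δc, hδc, hC⟩ := hC
  funext x z a b
  simp only [dper_apply]
  have sa := summable_dper M hA (hA.nonneg (Sum.inl 0)) hδa x z a b
  have sb := summable_dper M hB (hB.nonneg (Sum.inl 0)) hδb x z a b
  have sc := summable_dper M hC (hC.nonneg (Sum.inl 0)) hδc x z a b
  rw [(sa.neg.sub sb).tsum_sub sc, sa.neg.tsum_sub sb, tsum_neg]

end Helpers

/-! ## §1 The three words of `K3OfK` under the second bond's copy sum -/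

section Words

variable {N : ℕ} [NeZero N] {M' : Fin (d + 1) → ℕ} {K : MKer (d + 1) (Fib d)} {CK δK CS δS CM δM Cw δw : ℝ}
  {S Mt : Fin (d + 1) → Site (d + 1) → MKer (d + 1) (Fib d)}
  {W : Fin (d + 1) → Site (d + 1) → Fin (d + 1) → Site (d + 1) → MKer (d + 1) (Fib d)}

/-- [folklore] `dM` is bi-localised at its coarse bond and `K2OfK` likewise (some common constant and positive rate): `SecondOrderResponse.vertexFamily_dM ∕
vertexFamily_K2OfK` at the common rate `min δK (min δS δM)`. -/
theorem exists_biLoc_dM_K2OfK (hK : Decays K CK δK) (hδK : 0 < δK) (hS : ∀ κ u, BiLoc (S κ u) u u CS δS) (hδS : 0 < δS)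
    (hMloc : VertexFamily Mt N CM δM) (hδM : 0 < δM) :
    ∃ C δ : ℝ, 0 < δ ∧ (∀ μ y, BiLoc (dM K N S Mt μ y) ((N : ℤ) • y) ((N : ℤ) • y) C δ) ∧
      ∀ ν y', BiLoc (K2OfK K N S Mt ν y') ((N : ℤ) • y') ((N : ℤ) • y') C δ := by
  have hCK : 0 ≤ CK := hK.nonneg (Sum.inl 0)
  have hCS : 0 ≤ CS := (hS 0 0).nonneg (Sum.inl 0)
  have hCM : 0 ≤ CM := (hMloc 0 0).nonneg (Sum.inl 0)
  set r : ℝ := min δK (min δS δM) with hr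
  have hr0 : 0 < r := lt_min hδK (lt_min hδS hδM)
  have hKr : Decays K CK r := decays_mono hK hCK le_rfl (min_le_left _ _)
  have hSr : LocStencil S CS r := fun κ u => biLoc_mono (hS κ u) hCS ((min_le_right _ _).trans (min_le_left _ _))
  have hMr : VertexFamily Mt N CM r := vertexFamily_mono' hMloc hCM ((min_le_right _ _).trans (min_le_right _ _))
  have h1 := vertexFamily_dM (N := N) hK hCK hSr hMr hr0 (min_le_left _ _)
  have h2 := vertexFamily_K2OfK (N := N) hKr hCK hr0 hSr hMr
  have hc1 := cdM_nonneg (d := d) hCK hCS hCM hr0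
  have hc2 := cK2_nonneg (d := d) hCK hCS hCM hr0
  refine ⟨max (SecondOrderResponse.cdM d CK CS CM r) (SecondOrderResponse.cK2 d CK CS CM r), r / 8, by positivity, fun μ y => ?_, fun ν y' => ?_⟩
  · exact BalabanStepW2.biLoc_le_mono (h1 μ y) hc1 (le_max_left _ _) (by linarith)
  · exact BalabanStepW2.biLoc_le_mono (h2 ν y') hc2 (le_max_right _ _) le_rfl

/-- [folklore] **WORD 1 UNDER THE COPY SUM** (pointwise): the copies of `K2OfK_{b′}` along the coarse period are the fine-period shifts of ONE bi-localised kernel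
(C3c `K2OfK_translate_per`), so `Σ'_n (K·dM_b)·K2_{b′+M′∘n} = (K·dM_b)·dper M (K2_{b′})` (gan24-p3's `comp_dper_apply_eq_tsum` read backwards). -/
theorem tsum_word₁ (hM : ∀ i, M i = N * M' i)
    (hKinv : ∀ (m x z : Site (d + 1)) (a b : Fib d), K (translate M x m) (translate M z m) a b = K x z a b)
    (hK : Decays K CK δK) (hδK : 0 < δK)
    (hSt : ∀ (κ : Fin (d + 1)) (u m x z : Site (d + 1)) (a b : Fib d), S κ (translate M u m) (translate M x m) (translate M z m) a b = S κ u x z a b)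
    (hS : ∀ κ u, BiLoc (S κ u) u u CS δS) (hδS : 0 < δS)
    (hMt : ∀ (ρ : Fin (d + 1)) (w m x z : Site (d + 1)) (a b : Fib d), Mt ρ (translate M' w m) (translate M x m) (translate M z m) a b = Mt ρ w x z a b)
    (hMloc : VertexFamily Mt N CM δM) (hδM : 0 < δM) (μ : Fin (d + 1)) (y : Site (d + 1)) (ν : Fin (d + 1)) (y' : Site (d + 1))
    (x z : Site (d + 1)) (a b : Fib d) :
    ∑' n, comp (comp K (dM K N S Mt μ y)) (K2OfK K N S Mt ν (translate M' y' n)) x z a b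
      = comp (comp K (dM K N S Mt μ y)) (dper M (K2OfK K N S Mt ν y')) x z a b := by
  obtain ⟨C₀, δ₀, hδ₀, hdM, hK2⟩ := exists_biLoc_dM_K2OfK hK hδK hS hδS hMloc hδM
  obtain ⟨CB, δB, hδB, hB⟩ := exists_biLoc_comp_left hK hδK (hdM μ y) hδ₀
  obtain ⟨CB', δB', hδB', hBd⟩ := exists_decays_of_biLoc hB hδB
  rw [comp_dper_apply_eq_tsum M hBd hδB' (hK2 ν y') hδ₀ x z a b,
    ← (Equiv.neg (Site (d + 1))).tsum_eq fun j => comp (comp K (dM K N S Mt μ y)) (shiftK (fun i => (M i : ℤ) * j i) (K2OfK K N S Mt ν y')) x z a b]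
  refine tsum_congr fun n => ?_
  rw [K2OfK_translate_per M hM hKinv hSt hMt ν y' n]
  simp only [Equiv.neg_apply]

/-- [folklore] **WORD 2 UNDER THE COPY SUM** (pointwise): the copies of `dM_{b′}` are the shifts of one kernel (C3c `dM_translate_per`), the invariant `K` commutes
with the shift (`comp_shiftK_of_inv`), so `Σ'_n (K·dM_{b′+M′∘n})·K2_b = dper M (K·dM_{b′})·K2_b` (gan24-p3's `dper_comp_apply_eq_tsum` read backwards). -/
theorem tsum_word₂ (hM : ∀ i, M i = N * M' i)
    (hKinv : ∀ (m x z : Site (d + 1)) (a b : Fib d), K (translate M x m) (translate M z m) a b = K x z a b)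
    (hK : Decays K CK δK) (hδK : 0 < δK)
    (hSt : ∀ (κ : Fin (d + 1)) (u m x z : Site (d + 1)) (a b : Fib d), S κ (translate M u m) (translate M x m) (translate M z m) a b = S κ u x z a b)
    (hS : ∀ κ u, BiLoc (S κ u) u u CS δS) (hδS : 0 < δS)
    (hMt : ∀ (ρ : Fin (d + 1)) (w m x z : Site (d + 1)) (a b : Fib d), Mt ρ (translate M' w m) (translate M x m) (translate M z m) a b = Mt ρ w x z a b)
    (hMloc : VertexFamily Mt N CM δM) (hδM : 0 < δM) (μ : Fin (d + 1)) (y : Site (d + 1)) (ν : Fin (d + 1)) (y' : Site (d + 1))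
    (x z : Site (d + 1)) (a b : Fib d) :
    ∑' n, comp (comp K (dM K N S Mt ν (translate M' y' n))) (K2OfK K N S Mt μ y) x z a b
      = comp (dper M (comp K (dM K N S Mt ν y'))) (K2OfK K N S Mt μ y) x z a b := by
  obtain ⟨C₀, δ₀, hδ₀, hdM, hK2⟩ := exists_biLoc_dM_K2OfK hK hδK hS hδS hMloc hδM
  obtain ⟨CB, δB, hδB, hB⟩ := exists_biLoc_comp_left hK hδK (hdM ν y') hδ₀
  obtain ⟨CV, δV, hδV, hVd⟩ := exists_decays_of_biLoc (hK2 μ y) hδ₀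
  rw [dper_comp_apply_eq_tsum M hB hδB hVd hδV x z a b,
    ← (Equiv.neg (Site (d + 1))).tsum_eq fun j => comp (shiftK (fun i => (M i : ℤ) * j i) (comp K (dM K N S Mt ν y'))) (K2OfK K N S Mt μ y) x z a b]
  refine tsum_congr fun n => ?_
  rw [dM_translate_per M hM hKinv hSt hMt ν y' n, comp_shiftK_of_inv (shiftK_of_translate_inv M hKinv (-n))]
  simp only [Equiv.neg_apply]

omit [NeZero N] in
/-- [folklore] the `W` copies form a far-small family at the first bond: `|W b (b′+M′∘n) x z| ≤ (Cw · e^{−δw|N•b′ + M∘n − N•b|₁}) · e^{−δw(|x−N•b|₁+|z−N•b|₁)}`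
with `n ↦ e^{−δw|N•b′ + M∘n − N•b|₁}` summable. -/
theorem W_family (hM : ∀ i, M i = N * M' i)
    (hW : ∀ μ y ν y', BiLoc (W μ y ν y') ((N : ℤ) • y) ((N : ℤ) • y) (Cw * Real.exp (-δw * l1 ((N : ℤ) • y' - (N : ℤ) • y))) δw)
    (hδw : 0 < δw) (μ : Fin (d + 1)) (y : Site (d + 1)) (ν : Fin (d + 1)) (y' : Site (d + 1)) :
    (∀ n x z a b, |W μ y ν (translate M' y' n) x z a b|
        ≤ (Cw * Real.exp (-δw * l1 (translate M ((N : ℤ) • y') n - (N : ℤ) • y))) * Real.exp (-δw * (l1 (x - (N : ℤ) • y) + l1 (z - (N : ℤ) • y)))) ∧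
      Summable (fun n => Cw * Real.exp (-δw * l1 (translate M ((N : ℤ) • y') n - (N : ℤ) • y))) ∧
      ∀ n, 0 ≤ Cw * Real.exp (-δw * l1 (translate M ((N : ℤ) • y') n - (N : ℤ) • y)) := by
  have hCw : 0 ≤ Cw := by
    have h := (hW μ y μ y).nonneg (Sum.inl 0)
    rwa [sub_self, show l1 (0 : Site (d + 1)) = 0 by simp [l1], mul_zero, Real.exp_zero, mul_one] at h
  refine ⟨fun n x z a b => ?_, ((summable_exp_l1_translate M hδw ((N : ℤ) • y) ((N : ℤ) • y')).1).mul_left Cw, fun n => by positivity⟩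
  have h := hW μ y ν (translate M' y' n) x z a b
  rwa [nsmul_translate hM] at h

omit [NeZero N] in
/-- [folklore] **WORD 3 UNDER THE COPY SUM** (pointwise): `Σ'_n K·W_{b, b′+M′∘n}·K = K·(x z ↦ Σ'_n W_{b, b′+M′∘n} x z)·K` (C3c `tsum_sandwich_family`). -/
theorem tsum_word₃ (hM : ∀ i, M i = N * M' i) (hK : Decays K CK δK) (hδK : 0 < δK)
    (hW : ∀ μ y ν y', BiLoc (W μ y ν y') ((N : ℤ) • y) ((N : ℤ) • y) (Cw * Real.exp (-δw * l1 ((N : ℤ) • y' - (N : ℤ) • y))) δw)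
    (hδw : 0 < δw) (μ : Fin (d + 1)) (y : Site (d + 1)) (ν : Fin (d + 1)) (y' : Site (d + 1)) (x z : Site (d + 1)) (a b : Fib d) :
    ∑' n, comp (comp K (W μ y ν (translate M' y' n))) K x z a b
      = comp (comp K (fun x z a b => ∑' n, W μ y ν (translate M' y' n) x z a b)) K x z a b := by
  obtain ⟨hT, hg, hg0⟩ := W_family M hM hW hδw μ y ν y'
  exact tsum_sandwich_family hK hδK (T := fun n => W μ y ν (translate M' y' n)) hT hg hg0 hδw x z a b

/-- [folklore] pointwise summability in `n` of the three words (`biLoc_comp_biLoc` ∕ the sandwich give constants `c · e^{−δ′|N•b′ + M∘n − N•b|₁}`). -/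
theorem summable_words (hM : ∀ i, M i = N * M' i)
    (hKinv : ∀ (m x z : Site (d + 1)) (a b : Fib d), K (translate M x m) (translate M z m) a b = K x z a b)
    (hK : Decays K CK δK) (hδK : 0 < δK)
    (hSt : ∀ (κ : Fin (d + 1)) (u m x z : Site (d + 1)) (a b : Fib d), S κ (translate M u m) (translate M x m) (translate M z m) a b = S κ u x z a b)
    (hS : ∀ κ u, BiLoc (S κ u) u u CS δS) (hδS : 0 < δS)
    (hMt : ∀ (ρ : Fin (d + 1)) (w m x z : Site (d + 1)) (a b : Fib d), Mt ρ (translate M' w m) (translate M x m) (translate M z m) a b = Mt ρ w x z a b)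
    (hMloc : VertexFamily Mt N CM δM) (hδM : 0 < δM)
    (hW : ∀ μ y ν y', BiLoc (W μ y ν y') ((N : ℤ) • y) ((N : ℤ) • y) (Cw * Real.exp (-δw * l1 ((N : ℤ) • y' - (N : ℤ) • y))) δw)
    (hδw : 0 < δw) (μ : Fin (d + 1)) (y : Site (d + 1)) (ν : Fin (d + 1)) (y' : Site (d + 1)) (x z : Site (d + 1)) (a b : Fib d) :
    Summable (fun n => comp (comp K (dM K N S Mt μ y)) (K2OfK K N S Mt ν (translate M' y' n)) x z a b) ∧
      Summable (fun n => comp (comp K (dM K N S Mt ν (translate M' y' n))) (K2OfK K N S Mt μ y) x z a b) ∧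
      Summable (fun n => comp (comp K (W μ y ν (translate M' y' n))) K x z a b) := by
  have hCK : 0 ≤ CK := hK.nonneg (Sum.inl 0)
  obtain ⟨C₀, δ₀, hδ₀, hdM, hK2⟩ := exists_biLoc_dM_K2OfK hK hδK hS hδS hMloc hδM
  have hC₀ : 0 ≤ C₀ := (hdM 0 0).nonneg (Sum.inl 0)
  -- common rate for the two factors of the product words
  obtain ⟨CB, δB, hδB, hB⟩ := exists_biLoc_comp_left hK hδK (hdM μ y) hδ₀
  obtain ⟨CB', δB', hδB', hB'⟩ := exists_biLoc_comp_left hK hδK (hdM ν y') hδ₀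
  have hCB : 0 ≤ CB := hB.nonneg (Sum.inl 0)
  have hCB' : 0 ≤ CB' := hB'.nonneg (Sum.inl 0)
  have hsum : ∀ {a' : ℝ} (_ : 0 < a'), Summable fun n => Real.exp (-a' * l1 (translate M ((N : ℤ) • y') n - (N : ℤ) • y)) := fun ha' =>
    (summable_exp_l1_translate M ha' ((N : ℤ) • y) ((N : ℤ) • y')).1
  refine ⟨?_, ?_, ?_⟩
  · -- word 1: `B ∘ shiftK (M∘(−n)) V`, `B` at `N•y`, the shifted `V` at `N•y′ + M∘n`
    set r : ℝ := min δB δ₀ with hr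
    have hr0 : 0 < r := lt_min hδB hδ₀
    have hBr : BiLoc (comp K (dM K N S Mt μ y)) ((N : ℤ) • y) ((N : ℤ) • y) CB r := biLoc_mono hB hCB (min_le_left _ _)
    have hVr : ∀ n, BiLoc (shiftK (fun i => (M i : ℤ) * (-n) i) (K2OfK K N S Mt ν y')) (translate M ((N : ℤ) • y') n) (translate M ((N : ℤ) • y') n) C₀ r :=
      fun n => biLoc_shiftK_negper M (biLoc_mono (hK2 ν y') hC₀ (min_le_right _ _)) n
    have hT : ∀ n, BiLoc (comp (comp K (dM K N S Mt μ y)) (K2OfK K N S Mt ν (translate M' y' n))) ((N : ℤ) • y) (translate M ((N : ℤ) • y') n)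
        ((Fintype.card (Fib d) : ℝ) * (CB * C₀) * Zl (d + 1) (r / 2) * Real.exp (-(r / 2) * l1 (translate M ((N : ℤ) • y') n - (N : ℤ) • y))) r := by
      intro n
      rw [K2OfK_translate_per M hM hKinv hSt hMt ν y' n, l1_sub_symm]
      exact ExpKernelCalculus.biLoc_comp_biLoc hBr (hVr n) hr0
    exact summable_apply_of_biLoc hT hr0.le (by have := Zl_nonneg (D := d + 1) (half_pos hr0); positivity) (fun n => (Real.exp_pos _).le)
      (hsum (half_pos hr0)) x z a b
  · -- word 2: `shiftK (M∘(−n)) B′ ∘ V′`, the shifted `B′` at `N•y′ + M∘n`, `V′` at `N•y`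
    set r : ℝ := min δB' δ₀ with hr
    have hr0 : 0 < r := lt_min hδB' hδ₀
    have hBr : ∀ n, BiLoc (shiftK (fun i => (M i : ℤ) * (-n) i) (comp K (dM K N S Mt ν y'))) (translate M ((N : ℤ) • y') n) (translate M ((N : ℤ) • y') n)
        CB' r := fun n => biLoc_shiftK_negper M (biLoc_mono hB' hCB' (min_le_left _ _)) n
    have hVr : BiLoc (K2OfK K N S Mt μ y) ((N : ℤ) • y) ((N : ℤ) • y) C₀ r := biLoc_mono (hK2 μ y) hC₀ (min_le_right _ _)
    have hT : ∀ n, BiLoc (comp (comp K (dM K N S Mt ν (translate M' y' n))) (K2OfK K N S Mt μ y)) (translate M ((N : ℤ) • y') n) ((N : ℤ) • y)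
        ((Fintype.card (Fib d) : ℝ) * (CB' * C₀) * Zl (d + 1) (r / 2) * Real.exp (-(r / 2) * l1 (translate M ((N : ℤ) • y') n - (N : ℤ) • y))) r := by
      intro n
      rw [dM_translate_per M hM hKinv hSt hMt ν y' n, comp_shiftK_of_inv (shiftK_of_translate_inv M hKinv (-n))]
      exact ExpKernelCalculus.biLoc_comp_biLoc (hBr n) hVr hr0
    exact summable_apply_of_biLoc hT hr0.le (by have := Zl_nonneg (D := d + 1) (half_pos hr0); positivity) (fun n => (Real.exp_pos _).le)
      (hsum (half_pos hr0)) x z a b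
  · -- word 3: the sandwich of the far-small family
    obtain ⟨hT, hg, hg0⟩ := W_family M hM hW hδw μ y ν y'
    have hCw : 0 ≤ Cw := by
      have h := hg0 0
      rwa [CombHId2Product.translate_zero_right, mul_nonneg_iff_of_pos_right (Real.exp_pos _)] at h
    set r : ℝ := min δK δw with hr
    have hr0 : 0 < r := lt_min hδK hδw
    have hKr : Decays K CK r := decays_mono hK hCK le_rfl (min_le_left _ _)
    have hWr : ∀ n, BiLoc (W μ y ν (translate M' y' n)) ((N : ℤ) • y) ((N : ℤ) • y)
        (Cw * Real.exp (-δw * l1 (translate M ((N : ℤ) • y') n - (N : ℤ) • y))) r := fun n =>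
      biLoc_mono (fun x z a b => hT n x z a b) (hg0 n) (min_le_right _ _)
    have hT' : ∀ n, BiLoc (comp (comp K (W μ y ν (translate M' y' n))) K) ((N : ℤ) • y) ((N : ℤ) • y)
        (((Fintype.card (Fib d) : ℝ) * ((Fintype.card (Fib d) : ℝ) * (CK * Cw) * Zl (d + 1) (r / 2) * CK) * Zl (d + 1) (r / 4))
          * Real.exp (-δw * l1 (translate M ((N : ℤ) • y') n - (N : ℤ) • y))) (r / 4) := by
      intro n x z a b
      have h := SecondOrderResponse.biLoc_sandwich hKr hCK hr0 (hWr n) x z a b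
      rw [abs_neg] at h
      refine h.trans (le_of_eq ?_)
      ring
    exact summable_apply_of_biLoc hT' (by positivity)
      (by have := Zl_nonneg (D := d + 1) (half_pos hr0); have := Zl_nonneg (D := d + 1) (show 0 < r / 4 by positivity); positivity)
      (fun n => (Real.exp_pos _).le) (hsum hδw) x z a b

end Words

end Summit.QuantumFields.BalabanUV.Beta.CombHId2Words

end
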